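import Summits.QuantumFields.QCD.Theorems.GaussianLinkFramesFrameFMClosurePlacementSidesAux5

/-!
# Crux `GaussianLinkFrames.FrameFMClosure` (stmt-QuantumFields-17375), line `pad-the-fibre`, stub
`stub_placementSides` — helper 6: the balanced canonical placement for the BOX-COMPLEMENT side by the layered flip

Given a layer coordinate `lam` in which both `a` and `b` avoid the antipodal residue of the thinnest complement
(automatic when `r ≤ S - 2`) and a flip coordinate `nu ≠ lam`, the blocks of helper 5 for `a` and `b` (with aligned
`4`-ranges in coordinate `nu`, `nu_align`) are stable under ONE global map — flip `lam` along the box tiling when it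
lies inside the box, else flip `nu` along the aligned range pairing — which is a nearest-neighbour involution on
each clipped block; helper 5 of worker 1 (`balanced_touched_of_blocks`) then balances the touched region
(`boxc_balanced`).  The remaining configurations of the thinnest complement (`r = S - 1`, every coordinate of `a` or
of `b` antipodal) are treated separately.

References: elementary [folklore]; the pad recipe is the line card of `pad-the-fibre`.
-/

noncomputable section

open scoped BigOperators
open Literature.MathematicalPhysics.QuantumFieldTheory Literature.MathematicalPhysics.QuantumLattice
  Literature.Probability.LatticeModels
open Summit.QuantumFields.QCD.Theorems.VonMisesCircles Summit.QuantumFields.QCD.Theorems.PadTheFibre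

namespace Summit.QuantumFields.QCD.Theorems.PadTheFibreTwoStar

open Classical in
/-- **Balanced canonical placement for the box-complement side by the layered flip** (`4 ≤ S`, `1 ≤ r`,
`r + 1 ≤ S`, `lam ≠ nu`, and in coordinate `lam` both points inside the box or the complementary arc of `≥ 3`
residues): for any `a, b` there are pads holding `a`, `b` in their cores and canonical pad regions `Q₁, Q₂`
about them (forced links, `⊆ padLinks`) such that the touched region of `star(a) ∪ star(b) ∪ Q₁ ∪ Q₂` inside
`(ebox S z r)ᶜ` is bipartite-balanced. [folklore] -/
theorem boxc_balanced {S : ℕ} (hS : 4 ≤ S) (z : TorusSite 4 (2 * S + 1)) (r : ℕ) (hr₁ : 1 ≤ r) (hr₂ : r + 1 ≤ S)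
    (lam nu : Fin 4) (hln : lam ≠ nu) (a b : TorusSite 4 (2 * S + 1))
    (hla : (a lam - (z lam - ((r + 1 : ℕ) : ZMod (2 * S + 1)))).val ≤ 2 * r + 1 ∨ 2 * r + 5 ≤ 2 * S + 1)
    (hlb : (b lam - (z lam - ((r + 1 : ℕ) : ZMod (2 * S + 1)))).val ≤ 2 * r + 1 ∨ 2 * r + 5 ≤ 2 * S + 1) :
    ∃ (x' y' : TorusSite 4 (2 * S + 1)) (Q₁ Q₂ : Finset (Edge 4 (2 * S + 1))),
      a ∈ ebox S x' 0 ∧ b ∈ ebox S y' 0 ∧ IsPadRegion S x' Q₁ ∧ IsPadRegion S y' Q₂ ∧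
      Q₁ ⊆ padLinks S x' ∧ Q₂ ⊆ padLinks S y' ∧
      Balanced (touched S (ebox S z r)ᶜ (starLinks S a ∪ starLinks S b ∪ Q₁ ∪ Q₂)) := by
  haveI : NeZero (2 * S + 1) := ⟨by omega⟩
  have hS2 : 2 ≤ S := by omega
  obtain ⟨sa, sb, hsa, hsb, hal⟩ := nu_align (N := 2 * S + 1) (by omega) (a nu) (b nu)
  simp only at hal
  obtain ⟨hF1, hF2⟩ := hal
  obtain ⟨x', M₁, c₁, hc₁, hax, hast, hσ₁⟩ := boxc_block hS2 z r hr₁ hr₂ lam nu hln a sa hsa hla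
  obtain ⟨y', M₂, c₂, hc₂, hby, hbst, hσ₂⟩ := boxc_block hS2 z r hr₁ hr₂ lam nu hln b sb hsb hlb
  simp only at hσ₁ hσ₂
  obtain ⟨hν₁, hin₁, hout₁⟩ := hσ₁
  obtain ⟨hν₂, hin₂, hout₂⟩ := hσ₂
  set L : ZMod (2 * S + 1) := z lam - ((r + 1 : ℕ) : ZMod (2 * S + 1)) with hL
  set πB : ZMod (2 * S + 1) → ZMod (2 * S + 1) := fun u => if Even (u - L).val then u + 1 else u - 1 with hπB
  set fl : ZMod (2 * S + 1) → ZMod (2 * S + 1) → ZMod (2 * S + 1) := fun s u =>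
    if Even (u - s).val then u + 1 else u - 1 with hfl
  set πν : ZMod (2 * S + 1) → ZMod (2 * S + 1) := fun u => if (u - sa).val ≤ 3 then fl sa u else fl sb u with hπν
  set σ : TorusSite 4 (2 * S + 1) → TorusSite 4 (2 * S + 1) := fun y =>
    if (y lam - L).val ≤ 2 * r + 1 then Function.update y lam (πB (y lam)) else Function.update y nu (πν (y nu))
    with hσ
  set P₁ := ebox S x' 1 \ padFrozen S x' M₁ c₁ with hP₁
  set P₂ := ebox S y' 1 \ padFrozen S y' M₂ c₂ with hP₂
  set Q₁ := (padLinks S x').filter fun e : Edge 4 (2 * S + 1) =>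
    e.1 ∉ padFrozen S x' M₁ c₁ ∧ e.1.shift e.2 ∉ padFrozen S x' M₁ c₁ with hQ₁
  set Q₂ := (padLinks S y').filter fun e : Edge 4 (2 * S + 1) =>
    e.1 ∉ padFrozen S y' M₂ c₂ ∧ e.1.shift e.2 ∉ padFrozen S y' M₂ c₂ with hQ₂
  have hreg₁ : IsPadRegion S x' Q₁ := by
    have := isPadRegion_forced_union x' M₁ c₁ hc₁ ∅ (Finset.empty_subset _)
    rwa [Finset.union_empty] at this
  have hreg₂ : IsPadRegion S y' Q₂ := by
    have := isPadRegion_forced_union y' M₂ c₂ hc₂ ∅ (Finset.empty_subset _)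
    rwa [Finset.union_empty] at this
  refine ⟨x', y', Q₁, Q₂, hax, hby, hreg₁, hreg₂, Finset.filter_subset _ _, Finset.filter_subset _ _, ?_⟩
  have hsta := star_subset_forced x' a M₁ c₁ hast
  have hstb := star_subset_forced y' b M₂ c₂ hbst
  have hA : ∀ w : TorusSite 4 (2 * S + 1), w ∈ (ebox S z r)ᶜ ↔ w ∉ ebox S z r := fun w => Finset.mem_compl
  -- the range flips
  have hflr : ∀ s u : ZMod (2 * S + 1), (u - s).val ≤ 3 →
      (fl s u - s).val ≤ 3 ∧ fl s (fl s u) = u ∧ (fl s u = u + 1 ∨ u = fl s u + 1) := by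
    intro s u hu
    have F := flip_window s 0 3 ⟨0, rfl⟩ ⟨1, rfl⟩ (by omega) u (Nat.zero_le _) hu
    exact ⟨F.2.1, F.2.2.1, F.2.2.2.1⟩
  -- `σ` on an outside site of a block: the `nu`-flip stays in the range and is involutive
  have hout : ∀ (P : Finset (TorusSite 4 (2 * S + 1))) (s : ZMod (2 * S + 1)),
      (∀ y ∈ P, (y nu - s).val ≤ 3) → (∀ u, (u - s).val ≤ 3 → πν u = fl s u) →
      (∀ y ∈ P, y ∉ ebox S z r → ¬ (y lam - L).val ≤ 2 * r + 1 → ∀ v : ZMod (2 * S + 1), (v - s).val ≤ 3 →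
        Function.update y nu v ∈ P ∧ Function.update y nu v ∉ ebox S z r) →
      ∀ w ∈ P, w ∉ ebox S z r → ¬ (w lam - L).val ≤ 2 * r + 1 →
        σ w ∈ P ∧ σ w ∉ ebox S z r ∧ σ (σ w) = w ∧ (σ w = w + Pi.single nu 1 ∨ w = σ w + Pi.single nu 1) := by
    intro P s hνP hF houtP w hw hwA hwo
    have hws := hνP w hw
    obtain ⟨hr1, hr2, hr3⟩ := hflr s (w nu) hws
    have hπw : πν (w nu) = fl s (w nu) := hF _ hws
    have hσw : σ w = Function.update w nu (πν (w nu)) := by simp only [hσ]; rw [if_neg hwo]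
    obtain ⟨hm1, hm2⟩ := houtP w hw hwA hwo (πν (w nu)) (by rw [hπw]; exact hr1)
    rw [← hσw] at hm1 hm2
    refine ⟨hm1, hm2, ?_, ?_⟩
    · have hwo' : ¬ (σ w lam - L).val ≤ 2 * r + 1 := by rwa [hσw, Function.update_of_ne hln]
      have : σ (σ w) = Function.update (σ w) nu (πν (σ w nu)) := by simp only [hσ]; rw [if_neg hwo']
      rw [this, hσw, Function.update_self, hπw, hF _ hr1, hr2]
      simp
    · rcases hr3 with h | h
      · left; rw [hσw, hπw, h]; ext i
        by_cases hi : i = nu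
        · subst hi; simp
        · simp [hi]
      · right; rw [hσw, hπw]; ext i
        by_cases hi : i = nu
        · subst hi; simp; exact h
        · simp [hi]
  -- `σ` on an inside site of a block
  have hins : ∀ (P : Finset (TorusSite 4 (2 * S + 1))),
      (∀ y ∈ P, y ∉ ebox S z r → (y lam - L).val ≤ 2 * r + 1 →
        Function.update y lam (πB (y lam)) ∈ P ∧ Function.update y lam (πB (y lam)) ∉ ebox S z r ∧
        (πB (y lam) - L).val ≤ 2 * r + 1 ∧ πB (πB (y lam)) = y lam ∧
        (πB (y lam) = y lam + 1 ∨ y lam = πB (y lam) + 1)) →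
      ∀ w ∈ P, w ∉ ebox S z r → (w lam - L).val ≤ 2 * r + 1 →
        σ w ∈ P ∧ σ w ∉ ebox S z r ∧ σ (σ w) = w ∧ (σ w = w + Pi.single lam 1 ∨ w = σ w + Pi.single lam 1) := by
    intro P hinP w hw hwA hwi
    obtain ⟨hm1, hm2, hm3, hm4, hm5⟩ := hinP w hw hwA hwi
    have hσw : σ w = Function.update w lam (πB (w lam)) := by simp only [hσ]; rw [if_pos hwi]
    rw [← hσw] at hm1 hm2
    refine ⟨hm1, hm2, ?_, ?_⟩
    · have hwi' : (σ w lam - L).val ≤ 2 * r + 1 := by rwa [hσw, Function.update_self]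
      have : σ (σ w) = Function.update (σ w) lam (πB (σ w lam)) := by simp only [hσ]; rw [if_pos hwi']
      rw [this, hσw, Function.update_self, hm4]
      simp
    · rcases hm5 with h | h
      · left; rw [hσw, h]; ext i
        by_cases hi : i = lam
        · subst hi; simp
        · simp [hi]
      · right; rw [hσw]; ext i
        by_cases hi : i = lam
        · subst hi; simp; exact h
        · simp [hi]
  have hblk₁ : ∀ w ∈ P₁, w ∉ ebox S z r →
      σ w ∈ P₁ ∧ σ w ∉ ebox S z r ∧ σ (σ w) = w ∧ ∃ μ, σ w = w + Pi.single μ 1 ∨ w = σ w + Pi.single μ 1 := by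
    intro w hw hwA
    by_cases hwi : (w lam - L).val ≤ 2 * r + 1
    · obtain ⟨h1, h2, h3, h4⟩ := hins P₁ hin₁ w hw hwA hwi
      exact ⟨h1, h2, h3, lam, h4⟩
    · obtain ⟨h1, h2, h3, h4⟩ := hout P₁ sa hν₁ hF1 hout₁ w hw hwA hwi
      exact ⟨h1, h2, h3, nu, h4⟩
  have hblk₂ : ∀ w ∈ P₂, w ∉ ebox S z r →
      σ w ∈ P₂ ∧ σ w ∉ ebox S z r ∧ σ (σ w) = w ∧ ∃ μ, σ w = w + Pi.single μ 1 ∨ w = σ w + Pi.single μ 1 := by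
    intro w hw hwA
    by_cases hwi : (w lam - L).val ≤ 2 * r + 1
    · obtain ⟨h1, h2, h3, h4⟩ := hins P₂ hin₂ w hw hwA hwi
      exact ⟨h1, h2, h3, lam, h4⟩
    · obtain ⟨h1, h2, h3, h4⟩ := hout P₂ sb hν₂ hF2 hout₂ w hw hwA hwi
      exact ⟨h1, h2, h3, nu, h4⟩
  intro χ hχ
  refine balanced_touched_of_blocks (ebox S z r)ᶜ (starLinks S a ∪ starLinks S b ∪ Q₁ ∪ Q₂) P₁ P₂ σ
    ?_ ?_ ?_ ?_ ?_ ?_ ?_ χ hχ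
  · intro e he
    simp only [Finset.mem_union] at he
    rcases he with ((h | h) | h) | h
    · exact Or.inl (hsta e h)
    · exact Or.inr (hstb e h)
    · exact Or.inl ((mem_forced_iff x' M₁ c₁ e).1 h)
    · exact Or.inr ((mem_forced_iff y' M₂ c₂ e).1 h)
  · intro w μ hw hw'
    simp only [Finset.mem_union]
    exact Or.inl (Or.inr ((mem_forced_iff x' M₁ c₁ (w, μ)).2 ⟨hw, hw'⟩))
  · intro w μ hw hw'
    simp only [Finset.mem_union]
    exact Or.inr ((mem_forced_iff y' M₂ c₂ (w, μ)).2 ⟨hw, hw'⟩)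
  · intro w hw hwA
    have h := hblk₁ w hw ((hA w).1 hwA)
    exact ⟨h.1, (hA _).2 h.2.1⟩
  · intro w hw hwA
    have h := hblk₂ w hw ((hA w).1 hwA)
    exact ⟨h.1, (hA _).2 h.2.1⟩
  · intro w hw hwA
    rcases Finset.mem_union.1 hw with h | h
    · exact (hblk₁ w h ((hA w).1 hwA)).2.2.1
    · exact (hblk₂ w h ((hA w).1 hwA)).2.2.1
  · intro w hw hwA
    rcases Finset.mem_union.1 hw with h | h
    · exact (hblk₁ w h ((hA w).1 hwA)).2.2.2
    · exact (hblk₂ w h ((hA w).1 hwA)).2.2.2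

/-- **Registered helper `stub_placementSides_aux6` of crux stmt-QuantumFields-17375** (line `pad-the-fibre`, stub
`stub_placementSides`): the balanced canonical placement for the box-complement side by the layered flip (layer coordinate avoiding the antipodal residue). [folklore] -/
theorem stub_placementSides_aux6 : ∀ (S : ℕ), 4 ≤ S → ∀ (z : TorusSite 4 (2 * S + 1)) (r : ℕ), 1 ≤ r → r + 1 ≤ S → ∀ (lam nu : Fin 4), lam ≠ nu → ∀ (a b : TorusSite 4 (2 * S + 1)), ((a lam - (z lam - ((r + 1 : ℕ) : ZMod (2 * S + 1)))).val ≤ 2 * r + 1 ∨ 2 * r + 5 ≤ 2 * S + 1) → ((b lam - (z lam - ((r + 1 : ℕ) : ZMod (2 * S + 1)))).val ≤ 2 * r + 1 ∨ 2 * r + 5 ≤ 2 * S + 1) → ∃ (x' y' : TorusSite 4 (2 * S + 1)) (Q₁ Q₂ : Finset (Edge 4 (2 * S + 1))), a ∈ ebox S x' 0 ∧ b ∈ ebox S y' 0 ∧ IsPadRegion S x' Q₁ ∧ IsPadRegion S y' Q₂ ∧ Q₁ ⊆ padLinks S x' ∧ Q₂ ⊆ padLinks S y' ∧ Balanced (touched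 S (ebox S z r)ᶜ (starLinks S a ∪ starLinks S b ∪ Q₁ ∪ Q₂)) :=
  fun _ hS z r hr₁ hr₂ lam nu hln a b hla hlb => boxc_balanced hS z r hr₁ hr₂ lam nu hln a b hla hlb

end Summit.QuantumFields.QCD.Theorems.PadTheFibreTwoStar

end
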